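import Summits.QuantumFields.YangMills.Theorems.BalabanUVNodesK0Stub1FlatCurrentA1LineRowsAtRecord
import Summits.QuantumFields.YangMills.Theorems.BalabanUVNodesN07SocketFlatAtRecordExistsLam
import HarnessLib

/-!
# N07 (d′)-Lam, (R1) W3b: the ♭ package with the A₁ line's three rows, criticality in CELL FORM (S4-Lam, between W3 and W4)

WHY (n07-e memo `LOCATED-DPRIME-CALIBRATION` §4 (R1), `DPRIME-LAM-ROADMAP` §2).  k0-s1-w4's `exists_sectF_W_flatScaled_atRecord_socket_A1rows` re-exports k0-s1-w2's ♭ package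
with the three rows of Sect. F's current on the `A₁` line; its socket clause carries the determining-set criticality `IsCritOnFibre F N K 𝔹 …`, more than print's ([15]
(156)–(157)).  This file is the same statement over n07-e W3-Lam, the cell form threaded through; W4-Lam (`Letters10On`) consumes it.

WHAT IS PROVED (sorry-free; no definition; axioms standard): ★★★★ `exists_sectF_W_flatScaled_atRecord_socket_A1rows_lam` — k0-s1-w4's statement VERBATIM with the socket
clause's `∀ 𝔹, (bondsOf 𝔹 ⊆ LamBonds ≤ K − n) → ∀ U₁, reading → IsCritOnFibre … →` replaced by `∀ U₁, reading → (cell-form criticality) →`; proof VERBATIM over W3-Lam.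
HONEST FRAMING: a re-cut of one wrapper, no new analysis; NOTHING of [15]'s estimates asserted beyond the cited k0-s1 files; (d′) ∕ `HThm4RecDbar` ∕ budget row of MODULE 100
untouched; K0⁷ NOT closed; N07 NOT discharged; counts unmoved; one finite 𝕋⁴ programme at fixed ε — NOT continuum ∕ ℝ⁴ ∕ OS ∕ mass gap ∕ Clay.  No `sorry`, no `def`, no
`instance`, no `notation`.

References: [15] = Balaban1985Variational (27) p.282, (44)–(50) p.285, (55) p.286, (80) p.290, (98) p.293, (127)–(128) p.297, (152) p.301, (156)–(158) p.302; Balaban1985Averaging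
(92) p.31, Prop. 4 (134)–(135) p.38; Balaban1984PropagatorsII (2.3) p.224; Balaban1988Convergent (2.10)–(2.12) p.256.
-/

set_option autoImplicit false

noncomputable section

open scoped BigOperators Matrix Matrix.Norms.L2Operator Topology InnerProductSpace RealInnerProductSpace ContDiff
open Filter

namespace Summit.QuantumFields.YangMills.BalabanUVNodes.N07FlatCurrentA1LineRowsAtRecordLam

open Literature.MathematicalPhysics.QuantumFieldTheory.Balaban1983to89
open T4AdjointCovarianceUnitary (lieSU mem_lieSU_iff)
open B9AdOrthogonal (herm0 mem_herm0)
open MatrixNorms (ntr)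
open Summit.QuantumFields.YangMills.Theorems.K0Stub1FlatCurrentA1LineRows
/-! ## At every admissible family of the record's four-tori: dag-k0-s1-w2's ♭ package (p642782) RE-EXPORTED WITH THE A₁ LINE's THREE ROWS -/

section Record

open Literature.MathematicalPhysics.QuantumFieldTheory.Balaban1983to89.Node00
open T4Continuum (T4Family)
open B9Eq39Adjoint (bondPair)
open B15DeterminingSets (bondsOf DetSet avgFamily)
open B6SectADomainsV1 (Domains)
open B6SectAOperatorsV1 (BondIdx aE)
open B6SectAVectorModelV1 (EE)
open B11Eq26ActionExpansion (V0)
open B4Sect5Torus (TSite)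
open Summit.QuantumFields.YangMills.Theorems.FlatCubeOpsText (Adm22)
open Summit.QuantumFields.YangMills.Theorems.K0FlatCubeOpsTextP (IsLevWeight flatH levWeight_nonneg)
open Summit.QuantumFields.YangMills.Theorems.Prop8Chart (expCfg)
open Summit.QuantumFields.YangMills.Theorems.Prop8ChartDoubleBar (chartLogFlat)
open Summit.QuantumFields.YangMills.BalabanUVNodes.N07SocketFlatAtRecordExistsLam (exists_sectF_W_flatScaled_atRecord_socket_lam)

/-- ★★★★ **k0-s1-w4's ♭ package WITH THE A₁ LINE's THREE ROWS — CELL-FORM (Lam) EDITION** of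
`K0Stub1FlatCurrentA1LineRowsAtRecord.exists_sectF_W_flatScaled_atRecord_socket_A1rows`: the SAME ∃-package and the same three rows `hWq` ∕ `hWA` ∕ `hWtr` of Sect. F's
current along the `A₁` line, EXCEPT that the socket clause asks the criticality of the charted configuration `U₁` in the CORE's cell form (stationarity of `𝔄` along
differentiable `SU(N)` curves through `U₁` keeping the averages on the (2.3) CELLS `D.LamBond j c`, `j ≤ K − n`) instead of `IsCritOnFibre F N K 𝔹 …` for a determining set.
Proof = k0-s1-w4's VERBATIM (their `row98_flatCurrentA1`, `im_sum_trace_current_eq_zero_of_certificate_herm0`, `hreal_V80_herm0`, `conjTranspose_flatCurrentA1_eq_neg`,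
`trace_flatCurrentA1` cited by name) over n07-e W3-Lam `exists_sectF_W_flatScaled_atRecord_socket_lam`.
[cite: Balaban1985Variational, (27) p.282, (44)-(50) p.285, (55) p.286, (80) p.290, (98) p.293, (127)-(128) p.297, (152) p.301, (156)-(158) p.302; Balaban1985Averaging, (92) p.31, Prop. 4 (134)-(135) p.38; Balaban1984PropagatorsII, (2.3) p.224; Balaban1988Convergent, (2.10)-(2.12) p.256] -/
theorem exists_sectF_W_flatScaled_atRecord_socket_A1rows_lam (N : ℕ) [NeZero N] (F : T4Family) :
    ∃ (Mh₀ R₀ : ℕ) (ε C₄ : ℝ), 0 < ε ∧ 0 ≤ C₄ ∧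
    ∀ (n K : ℕ) (_ : 1 ≤ K - n) (_ : K - n + 1 ≤ F.m + K) {Mh R a' : ℕ} (_ : Mh = F.L ^ a') (_ : Mh₀ ≤ Mh) (_ : R₀ ≤ R)
      (_ : a' + 3 ≤ F.m + n) (D : Domains (F.P K)) (_ : D.k = K - n) (_ : Adm22 D R (F.L * Mh))
      {w : ℕ → PBond (F.P K) 0 → ℝ} (_ : IsLevWeight (F.P K) (K - n) D w),
    ∃ (τ : Matrix (Fin N) (Fin N) ℂ →L[ℂ] ℂ) (ρ : (Matrix (Fin N) (Fin N) ℂ →L[ℂ] ℂ) →L[ℂ] Matrix (Fin N) (Fin N) ℂ)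
      (BE : (PBond (F.P K) 0 → Matrix (Fin N) (Fin N) ℂ) →L[ℂ] (PBond (F.P K) 0 → Matrix (Fin N) (Fin N) ℂ) →L[ℂ] ℂ)
      (B : (BondIdx D → Matrix (Fin N) (Fin N) ℂ) →L[ℂ] (BondIdx D → Matrix (Fin N) (Fin N) ℂ) →L[ℂ] ℂ)
      (hc : ((F.P K).L : ℝ) ^ (K - n) ≠ 0) (hwa : ∀ _i : BondIdx D, (0 : ℝ) < 1)
      (MV : (BondIdx D → Matrix (Fin N) (Fin N) ℂ) →L[ℂ] (BondIdx D → Matrix (Fin N) (Fin N) ℂ))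
      (H : (BondIdx D → Matrix (Fin N) (Fin N) ℂ) →ₗ[ℂ] (PBond (F.P K) 0 → Matrix (Fin N) (Fin N) ℂ))
      (Dsel : (PBond (F.P K) 0 → Matrix (Fin N) (Fin N) ℂ) → (BondIdx D → Matrix (Fin N) (Fin N) ℂ))
      (Qt : (BondIdx D → Matrix (Fin N) (Fin N) ℂ) →L[ℂ] (PBond (F.P K) 0 → Matrix (Fin N) (Fin N) ℂ))
      (Ht : (PBond (F.P K) 0 → Matrix (Fin N) (Fin N) ℂ) →L[ℂ] (BondIdx D → Matrix (Fin N) (Fin N) ℂ))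
      (Dt : (PBond (F.P K) 0 → Matrix (Fin N) (Fin N) ℂ) → ((BondIdx D → Matrix (Fin N) (Fin N) ℂ) →L[ℂ] (PBond (F.P K) 0 → Matrix (Fin N) (Fin N) ℂ)))
      (e : Site (F.P K) 0 ≃ TSite (F.P K).d (fun _ => (F.P K).sitesPerDir 0))
      (W : (PBond (F.P K) 0 → Matrix (Fin N) (Fin N) ℂ) → (PBond (F.P K) 0 → Matrix (Fin N) (Fin N) ℂ)),
      -- the objects of record
      (∀ X, τ X = ntr X) ∧ (∀ (ℓ' : Matrix (Fin N) (Fin N) ℂ →L[ℂ] ℂ) (X : Matrix (Fin N) (Fin N) ℂ), τ (ρ ℓ' * X) = ℓ' X) ∧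
      (∀ Y δ : PBond (F.P K) 0 → Matrix (Fin N) (Fin N) ℂ, BE Y δ =
        bondPair ((((F.P K).L : ℝ))⁻¹ ^ (K - n)) (F.P K).d (τ : Matrix (Fin N) (Fin N) ℂ →ₗ[ℂ] ℂ) (fun μ x => Y ⟨x, μ⟩) (fun μ x => δ ⟨x, μ⟩)) ∧
      (∀ X X' : BondIdx D → Matrix (Fin N) (Fin N) ℂ, B X X' = ∑ t, τ (X t * X' t)) ∧
      (∀ (X : BondIdx D → Matrix (Fin N) (Fin N) ℂ) (t : BondIdx D),
        MV X t = ∑ s, (((((F.P K).L : ℝ) ^ (t.1.1 : ℕ) * ((((F.P K).L : ℝ))⁻¹) ^ (K - n))⁻¹ *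
          WithLp.ofLp ((EE D hc hwa - aE D (fun _ => (1 : ℝ))) (WithLp.toLp 2 (Pi.single s 1))) t *
          (((F.P K).L : ℝ) ^ (s.1.1 : ℕ) * ((((F.P K).L : ℝ))⁻¹) ^ (K - n))⁻¹ : ℝ) : ℂ) • X s) ∧
      (∀ (X : BondIdx D → Matrix (Fin N) (Fin N) ℂ) (b : PBond (F.P K) 0), H X b =
        ∑ t, (((((F.P K).L : ℝ) ^ (t.1.1 : ℕ) * ((((F.P K).L : ℝ))⁻¹) ^ (K - n))⁻¹ * flatH (F.P K) (K - n) D (Pi.single t 1) b : ℝ) : ℂ) • X t) ∧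
      -- the implicit ♭ chart on the `ε`-ball: (55)♭, analyticity, (49)♭, (48)♭
      (∀ A' : PBond (F.P K) 0 → Matrix (Fin N) (Fin N) ℂ, (∀ b, w 1 b * ‖A' b‖ < ε) →
        ∀ ρ' : ℝ, 0 ≤ ρ' → (∀ b, w 1 b * ‖A' b‖ ≤ ρ') → ∀ i : BondIdx D, ‖Dsel A' i‖ ≤ C₄ * ρ' ^ 2) ∧
      ContDiffOn ℂ ω Dsel {Y : PBond (F.P K) 0 → Matrix (Fin N) (Fin N) ℂ | ∀ b, w 1 b * ‖Y b‖ < ε} ∧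
      (∀ A' : PBond (F.P K) 0 → Matrix (Fin N) (Fin N) ℂ, (∀ b, w 1 b * ‖A' b‖ < ε) →
        chartLogFlat (((((F.P K).L : ℝ))⁻¹) ^ (K - n)) D (A' - H (Dsel A')) - (fderiv ℂ (chartLogFlat (((((F.P K).L : ℝ))⁻¹) ^ (K - n)) D :
        (PBond (F.P K) 0 → Matrix (Fin N) (Fin N) ℂ) → BondIdx D → Matrix (Fin N) (Fin N) ℂ) 0) (A' - H (Dsel A')) = Dsel A' ∧
        chartLogFlat (((((F.P K).L : ℝ))⁻¹) ^ (K - n)) D (A' - H (Dsel A')) = (fderiv ℂ (chartLogFlat (((((F.P K).L : ℝ))⁻¹) ^ (K - n)) D :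
        (PBond (F.P K) 0 → Matrix (Fin N) (Fin N) ℂ) → BondIdx D → Matrix (Fin N) (Fin N) ℂ) 0) A') ∧
      -- the reality of the implicit ♭ chart on Hermitian-traceless fields (dag-k0-s1-w4 CLAIM-8, threaded through C‴)
      (∀ A' : PBond (F.P K) 0 → Matrix (Fin N) (Fin N) ℂ, (∀ b, w 1 b * ‖A' b‖ < ε) → (∀ b, A' b ∈ herm0 (Fin N)) →
        (∀ i, Dsel A' i ∈ herm0 (Fin N)) ∧ ∀ b, (A' - H (Dsel A')) b ∈ herm0 (Fin N)) ∧
      -- the transposes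
      (∀ X δ, BE (Qt X) δ = B X ((fderiv ℂ (chartLogFlat (((((F.P K).L : ℝ))⁻¹) ^ (K - n)) D :
        (PBond (F.P K) 0 → Matrix (Fin N) (Fin N) ℂ) → BondIdx D → Matrix (Fin N) (Fin N) ℂ) 0) δ)) ∧
      (∀ Z X, BE Z (H X) = B (Ht Z) X) ∧
      (∀ (A' : PBond (F.P K) 0 → Matrix (Fin N) (Fin N) ℂ) X δ, BE (Dt A' X) δ = B X (fderiv ℂ Dsel A' δ)) ∧
      -- the chart, (157), the window, the (158)∕(98) row
      (∀ (x : Site (F.P K) 0) (μ : Fin (F.P K).d), e (x.shift μ) = B9SectCLatticeCarrier.shift μ (e x)) ∧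
      (∀ A' : PBond (F.P K) 0 → Matrix (Fin N) (Fin N) ℂ, (∀ b, w 1 b * ‖A' b‖ < ε) →
        (∀ (b : PBond (F.P K) 0) (ν : Fin (F.P K).d), w 2 b * ((F.P K).L : ℝ) ^ (K - n) * ‖A' ⟨b.src.shift ν, b.dir⟩ - A' b‖ < ε) →
        HasFDerivAt (fun A : PBond (F.P K) 0 → Matrix (Fin N) (Fin N) ℂ => 2⁻¹ * B (Dsel A) (((((((((F.P K).L : ℝ))⁻¹) ^ (K - n) : ℝ) : ℂ) ^ (F.P K).d) • MV) (Dsel A))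
            - B ((fderiv ℂ (chartLogFlat (((((F.P K).L : ℝ))⁻¹) ^ (K - n)) D :
        (PBond (F.P K) 0 → Matrix (Fin N) (Fin N) ℂ) → BondIdx D → Matrix (Fin N) (Fin N) ℂ) 0) A)
                (((((((((F.P K).L : ℝ))⁻¹) ^ (K - n) : ℝ) : ℂ) ^ (F.P K).d) • MV) (Dsel A))
            + V0 (LatticeFieldCalculus.shiftEquiv (P := F.P K) (j := 0)) (fun _ _ => (1 : (Matrix (Fin N) (Fin N) ℂ)ˣ)) ((((F.P K).L : ℝ)⁻¹) ^ (K - n)) (F.P K).d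
                (τ : Matrix (Fin N) (Fin N) ℂ →ₗ[ℂ] ℂ) (fun μ x => (A - H (Dsel A)) ⟨x, μ⟩))
          (BE (W A')) A') ∧
      DifferentiableOn ℂ W {Y : PBond (F.P K) 0 → Matrix (Fin N) (Fin N) ℂ | (∀ b, w 1 b * ‖Y b‖ < ε) ∧
        ∀ (b : PBond (F.P K) 0) (ν : Fin (F.P K).d), w 2 b * ((F.P K).L : ℝ) ^ (K - n) * ‖Y ⟨b.src.shift ν, b.dir⟩ - Y b‖ < ε} ∧
      (∀ (Y : PBond (F.P K) 0 → Matrix (Fin N) (Fin N) ℂ) (r : ℝ), r < ε → (∀ b, w 1 b * ‖Y b‖ ≤ r) →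
        (∀ (b : PBond (F.P K) 0) (ν : Fin (F.P K).d), w 2 b * ((F.P K).L : ℝ) ^ (K - n) * ‖Y ⟨b.src.shift ν, b.dir⟩ - Y b‖ ≤ r) →
        ∀ b, w 3 b * ‖W Y b‖ ≤ C₄ * r ^ 2) ∧
      -- ★ THE ♭ (127) SOCKET: small Hermitian-traceless base points whose charted configuration is critical on the record's fibre, kernel directions
      (∀ (A₁ δ : PBond (F.P K) 0 → Matrix (Fin N) (Fin N) ℂ), (∀ b, w 1 b * ‖A₁ b‖ < ε) →
        (∀ (b : PBond (F.P K) 0) (ν : Fin (F.P K).d), w 2 b * ((F.P K).L : ℝ) ^ (K - n) * ‖A₁ ⟨b.src.shift ν, b.dir⟩ - A₁ b‖ < ε) →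
        (∀ b, A₁ b ∈ herm0 (Fin N)) → (∀ b, δ b ∈ herm0 (Fin N)) →
        (fderiv ℂ (chartLogFlat (((((F.P K).L : ℝ))⁻¹) ^ (K - n)) D :
          (PBond (F.P K) 0 → Matrix (Fin N) (Fin N) ℂ) → BondIdx D → Matrix (Fin N) (Fin N) ℂ) 0) δ = 0 →
        ∀ (U₁ : GaugeField (F.P K) 0 (SU N)),
          (∀ b, ((U₁ b : SU N) : Matrix (Fin N) (Fin N) ℂ) = ((expCfg ((((F.P K).L : ℝ)⁻¹) ^ (K - n)) (A₁ - H (Dsel A₁)) b : (Matrix (Fin N) (Fin N) ℂ)ˣ) : _)) →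
          -- the criticality of the charted configuration, CELL FORM (print's (ii)-reading of [15] (156)–(157); no determining set)
          (∀ γ : ℝ → GaugeField (F.P K) 0 (SU N), γ 0 = U₁ →
            DifferentiableAt ℝ (fun (t : ℝ) (b : PBond (F.P K) 0) => ((γ t b : SU N) : Matrix (Fin N) (Fin N) ℂ)) 0 →
            (∀ (t : ℝ) (j : ℕ) (c : PBond (F.P K) j), j ≤ K - n → D.LamBond j c →
              avgFamily (avOfRecord F N K) (γ t) j c = avgFamily (avOfRecord F N K) U₁ j c) →
            HasDerivAt (fun t => wilsonAction4 (γ t)) 0 0) →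
        ∀ (X₁ δX : TangentBondSU (F.P K) 0 N),
          (∀ b, ((X₁ b : lieSU (Fin N)) : Matrix (Fin N) (Fin N) ℂ) = (Complex.I * (((((F.P K).L : ℝ)⁻¹) ^ (K - n) : ℝ) : ℂ)) • A₁ b) →
          (∀ b, ((δX b : lieSU (Fin N)) : Matrix (Fin N) (Fin N) ℂ) = (Complex.I * (((((F.P K).L : ℝ)⁻¹) ^ (K - n) : ℝ) : ℂ)) • δ b) →
          ⟪δX, hessOpAt ((((F.P K).L : ℝ)⁻¹) ^ (K - n)) (1 : GaugeField (F.P K) 0 (SU N)) X₁⟫_ℝ + (BE (W A₁) δ).re = 0) ∧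
      -- ★ dag-k0-s1-w4 g3: THE A₁ LINE's ROWS for dag-k0-s1-w1's current `W_A₁ Y := (i·c²·η^d·η⁻¹)•(W((iη)⁻¹•Y))♮` (`c = L^{K−n}`, `η = L^{−(K−n)}`): `hWq` on the window `r < η·ε` …
      (∀ (Y : PBond (F.P K) 0 → Matrix (Fin N) (Fin N) ℂ) (r : ℝ), r < ((((F.P K).L : ℝ)⁻¹) ^ (K - n)) * ε → (∀ b, w 1 b * ‖Y b‖ ≤ r) →
        (∀ (b : PBond (F.P K) 0) (ν : Fin 4), w 2 b * (F.L : ℝ) ^ (K - n) * ‖Y ⟨b.src.shift ν, b.dir⟩ - Y b‖ ≤ r) →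
        ∀ b, w 3 b * ‖(Complex.I * ((((F.P K).L ^ (K - n) : ℝ)) : ℂ) ^ 2 * (((((F.P K).L : ℝ)⁻¹) ^ (K - n) : ℝ) : ℂ) ^ (F.P K).d * ((((((F.P K).L : ℝ)⁻¹) ^ (K - n) : ℝ) : ℂ))⁻¹) •
          (W (fun b' => (Complex.I * (((((F.P K).L : ℝ)⁻¹) ^ (K - n) : ℝ) : ℂ))⁻¹ • Y b') b - (((N : ℂ))⁻¹ * (W (fun b' => (Complex.I * (((((F.P K).L : ℝ)⁻¹) ^ (K - n) : ℝ) : ℂ))⁻¹ • Y b') b).trace) • (1 : Matrix (Fin N) (Fin N) ℂ))‖ ≤ (2 * (((F.P K).L ^ (K - n) : ℝ) ^ 2 * ((((F.P K).L : ℝ)⁻¹) ^ (K - n)) ^ (F.P K).d * ((((F.P K).L : ℝ)⁻¹) ^ (K - n))⁻¹) * ((((F.P K).L : ℝ)⁻¹) ^ (K - n))⁻¹ ^ 2 * C₄) * r ^ 2) ∧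
      -- … and `hWA` ∧ `hWtr` at every `𝔰𝔲(N)`-valued `X` whose Hermitian letter `(iη)⁻¹•X` lies in the two-size window (`ρ′ < η·ε`)
      (∀ (X : PBond (F.P K) 0 → lieSU (Fin N)) (ρ' : ℝ), ρ' < ((((F.P K).L : ℝ)⁻¹) ^ (K - n)) * ε →
        (∀ b, w 1 b * ‖((X b : lieSU (Fin N)) : Matrix (Fin N) (Fin N) ℂ)‖ ≤ ρ') →
        (∀ (b : PBond (F.P K) 0) (ν : Fin 4), w 2 b * (F.L : ℝ) ^ (K - n) *
          ‖((X ⟨b.src.shift ν, b.dir⟩ : lieSU (Fin N)) : Matrix (Fin N) (Fin N) ℂ) - ((X b : lieSU (Fin N)) : Matrix (Fin N) (Fin N) ℂ)‖ ≤ ρ') →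
        (∀ j, ((Complex.I * ((((F.P K).L ^ (K - n) : ℝ)) : ℂ) ^ 2 * (((((F.P K).L : ℝ)⁻¹) ^ (K - n) : ℝ) : ℂ) ^ (F.P K).d * ((((((F.P K).L : ℝ)⁻¹) ^ (K - n) : ℝ) : ℂ))⁻¹) •
            (W (fun b => (Complex.I * (((((F.P K).L : ℝ)⁻¹) ^ (K - n) : ℝ) : ℂ))⁻¹ • ((X b : lieSU (Fin N)) : Matrix (Fin N) (Fin N) ℂ)) j - (((N : ℂ))⁻¹ * (W (fun b => (Complex.I * (((((F.P K).L : ℝ)⁻¹) ^ (K - n) : ℝ) : ℂ))⁻¹ • ((X b : lieSU (Fin N)) : Matrix (Fin N) (Fin N) ℂ)) j).trace) • (1 : Matrix (Fin N) (Fin N) ℂ)))ᴴ =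
          -((Complex.I * ((((F.P K).L ^ (K - n) : ℝ)) : ℂ) ^ 2 * (((((F.P K).L : ℝ)⁻¹) ^ (K - n) : ℝ) : ℂ) ^ (F.P K).d * ((((((F.P K).L : ℝ)⁻¹) ^ (K - n) : ℝ) : ℂ))⁻¹) •
            (W (fun b => (Complex.I * (((((F.P K).L : ℝ)⁻¹) ^ (K - n) : ℝ) : ℂ))⁻¹ • ((X b : lieSU (Fin N)) : Matrix (Fin N) (Fin N) ℂ)) j - (((N : ℂ))⁻¹ * (W (fun b => (Complex.I * (((((F.P K).L : ℝ)⁻¹) ^ (K - n) : ℝ) : ℂ))⁻¹ • ((X b : lieSU (Fin N)) : Matrix (Fin N) (Fin N) ℂ)) j).trace) • (1 : Matrix (Fin N) (Fin N) ℂ)))) ∧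
        ∀ j, ((Complex.I * ((((F.P K).L ^ (K - n) : ℝ)) : ℂ) ^ 2 * (((((F.P K).L : ℝ)⁻¹) ^ (K - n) : ℝ) : ℂ) ^ (F.P K).d * ((((((F.P K).L : ℝ)⁻¹) ^ (K - n) : ℝ) : ℂ))⁻¹) •
            (W (fun b => (Complex.I * (((((F.P K).L : ℝ)⁻¹) ^ (K - n) : ℝ) : ℂ))⁻¹ • ((X b : lieSU (Fin N)) : Matrix (Fin N) (Fin N) ℂ)) j - (((N : ℂ))⁻¹ * (W (fun b => (Complex.I * (((((F.P K).L : ℝ)⁻¹) ^ (K - n) : ℝ) : ℂ))⁻¹ • ((X b : lieSU (Fin N)) : Matrix (Fin N) (Fin N) ℂ)) j).trace) • (1 : Matrix (Fin N) (Fin N) ℂ))).trace = 0) := by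
  obtain ⟨Mh₀, R₀, ε, C₄, hε, hC₄, hmain⟩ := exists_sectF_W_flatScaled_atRecord_socket_lam N F
  refine ⟨Mh₀, R₀, ε, C₄, hε, hC₄, ?_⟩
  intro n K hk1 hk' Mh R a' hMha hMh hR hsize D hDk hAdm w hw
  obtain ⟨τ, ρ, BE, B, hc, hwa, MV, H, Dsel, Qt, Ht, Dt, e, W, hntr, hρ, hBE, hB, hMV, hH, h55, hcd, hfix, hherm, hQt, hHt, hDt, he, h157,
    hdiff, h158, hsock⟩ := hmain n K hk1 hk' hMha hMh hR hsize D hDk hAdm hw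
  refine ⟨τ, ρ, BE, B, hc, hwa, MV, H, Dsel, Qt, Ht, Dt, e, W, hntr, hρ, hBE, hB, hMV, hH, h55, hcd, hfix, hherm, hQt, hHt, hDt, he, h157,
    hdiff, h158, hsock, ?_, ?_⟩
  · -- `hWq` (§3 `row98_flatCurrentA1` on D‴'s (98) row)
    have hL0 : (0 : ℝ) < ((F.P K).L : ℝ) := by exact_mod_cast (F.P K).L_pos
    have hη0 : (0 : ℝ) < ((((F.P K).L : ℝ)⁻¹) ^ (K - n)) := pow_pos (inv_pos.2 hL0) _
    intro Y r hr h1 h2 b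
    exact row98_flatCurrentA1 (P := F.P K) ((((F.P K).L : ℝ)⁻¹) ^ (K - n)) ((F.P K).L ^ (K - n) : ℝ) hη0 w (fun b => levWeight_nonneg hw 3 b) W h158 Y r hr h1 h2 b
  · -- `hWA` ∧ `hWtr` (§3 over §2's herm0-line reality of the current at every Hermitian-traceless point of the window)
    have hL0 : (0 : ℝ) < ((F.P K).L : ℝ) := by exact_mod_cast (F.P K).L_pos
    have hη0 : (0 : ℝ) < ((((F.P K).L : ℝ)⁻¹) ^ (K - n)) := pow_pos (inv_pos.2 hL0) _
    obtain ⟨hτ, hτs⟩ := ntr_letters τ hntr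
    have hMsa : ∀ X : BondIdx D → Matrix (Fin N) (Fin N) ℂ, (∀ s, IsSelfAdjoint (X s)) →
        ∀ t, IsSelfAdjoint ((((((((F.P K).L : ℝ)⁻¹) ^ (K - n) : ℝ) : ℂ) ^ (F.P K).d) • MV) X t) := fun X hX t =>
      isSelfAdjoint_smul_realKernelC MV _ hMV (by rw [map_pow, Complex.conj_ofReal]) hX t
    have hQsa : ∀ A : PBond (F.P K) 0 → Matrix (Fin N) (Fin N) ℂ, (∀ b, IsSelfAdjoint (A b)) →
        ∀ c, IsSelfAdjoint ((fderiv ℂ (chartLogFlat ((((F.P K).L : ℝ)⁻¹) ^ (K - n)) D : (PBond (F.P K) 0 → Matrix (Fin N) (Fin N) ℂ) → BondIdx D → Matrix (Fin N) (Fin N) ℂ) 0) A c) :=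
      fun A hA c => isSelfAdjoint_fderiv_chartLogFlat_zero ((((F.P K).L : ℝ)⁻¹) ^ (K - n)) D hA c
    have hWreal : ∀ A' : PBond (F.P K) 0 → Matrix (Fin N) (Fin N) ℂ, (∀ b, w 1 b * ‖A' b‖ < ε) →
        (∀ (b : PBond (F.P K) 0) (ν : Fin (F.P K).d), w 2 b * ((F.P K).L : ℝ) ^ (K - n) * ‖A' ⟨b.src.shift ν, b.dir⟩ - A' b‖ < ε) →
        (∀ b, A' b ∈ herm0 (Fin N)) → ∀ δ : PBond (F.P K) 0 → Matrix (Fin N) (Fin N) ℂ, (∀ b, δ b ∈ herm0 (Fin N)) → (∑ b, (W A' b * δ b).trace).im = 0 :=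
      fun A' hA1 hA2 hAh δ hδ =>
        im_sum_trace_current_eq_zero_of_certificate_herm0 hη0.ne' τ hntr BE hBE _ (h157 A' hA1 hA2)
          (hreal_V80_herm0 (K - n) τ hτ hτs B hB H _ hMsa _ hQsa Dsel hherm hA1 hAh) δ hδ
    intro X ρ' hρ' h1 h2
    exact ⟨fun j => conjTranspose_flatCurrentA1_eq_neg ((((F.P K).L : ℝ)⁻¹) ^ (K - n)) ((F.P K).L ^ (K - n) : ℝ) hη0 w W hWreal X hρ' h1 h2 j,
      fun j => trace_flatCurrentA1 ((((F.P K).L : ℝ)⁻¹) ^ (K - n)) ((F.P K).L ^ (K - n) : ℝ) W _ j⟩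

end Record

end Summit.QuantumFields.YangMills.BalabanUVNodes.N07FlatCurrentA1LineRowsAtRecordLam

end
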